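import Literature.AlgebraicGeometry.Resolution.QuasiExcellentLocalization
import Mathlib.RingTheory.EssentialFiniteness
import HarnessLib

/-!
# Finite type algebras over quasi-excellent rings: `Stacks07QU` from the G-ring proposition 07PV

Topic: `Literature/AlgebraicGeometry/Resolution`. Second bottom-up step on the leaf `Stacks07QU`
(`GeneralLU.lean`: a finite type algebra over a quasi-excellent ring is quasi-excellent —
Stacks, Tag 07QU) of the decomposition of `Temkin2008` (`Temkin2008Localization.lean`,
`QuasiExcellentLocalization.lean`). The Stacks Project proves 07QU in one line: "For finite
type algebras this follows from the definitions for the properties J-2 and universally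
catenary. For G-rings, see Proposition 15.51.10. We omit the proof that localization
preserves (quasi-)excellency." With the J-2 and localization parts PROVED
(`IsJ2Ring.of_finiteType`, `isJ2Ring_of_isLocalization`, `isGRing_of_isLocalization`), the
only unproved input of 07QU is the G-ring proposition it quotes, vendored here AS PRINTED:

* `Stacks07PV` — NAMED FACT, Stacks Tag 07PV = Proposition 15.51.10: "Let `R` be a G-ring. If
  `R → S` is essentially of finite type then `S` is a G-ring." (Grothendieck's theorem on the
  formal fibres of finite type algebras; "essentially of finite type" = a localization of a
  finite type algebra = Mathlib's `Algebra.EssFiniteType`.)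
* PROVED: `IsJ2Ring.of_essFiniteType` (J-2 passes to essentially finite type algebras),
  `IsQuasiExcellentRing.of_essFiniteType` (under `Stacks07PV`), `stacks07QU_of_stacks07PV :
  Stacks07PV → Stacks07QU`, `Stacks07PV.stacks07QU_asPrinted` (07QU for quasi-excellent rings
  in its printed generality: any localization of a finite type algebra), and the assembly
  `temkin2008_of_stacks07PV : Temkin2008_prop234 → Hironaka1964_local → Stacks07PV → Temkin2008`.

After this file the trust base of `Temkin2008` (`Temkin2008.lean`) is
{`Temkin2008_prop234` (Temkin 2008 Prop. 2.3.4), `Hironaka1964_local` (Hironaka 1964 Main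
Theorem I over local quasi-excellent rings), `Stacks07PV` (Stacks 15.51.10)}.

## Sources

* The Stacks Project, Tag 07PV (= Prop. 15.51.10, quoted above), Tag 07QU (= Lemma 15.53.2 and
  its proof, quoted above), Tag 07QT (= Def. 15.53.1: quasi-excellent = Noetherian + G-ring +
  J-2), Tag 07P7 (= Def. 15.48.1, J-2). [StacksProject]
* H. Matsumura, *Commutative Ring Theory*, CUP 1986, §32 p. 260. [Matsumura1987]
-/

noncomputable section

open CategoryTheory AlgebraicGeometry TopologicalSpace IsLocalRing

namespace Literature.AlgebraicGeometry.Resolution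

universe u

/-! ## The named fact -/

/-- NAMED FACT — **Stacks, Tag 07PV** (= Proposition 15.51.10): "Let `R` be a G-ring. If
`R → S` is essentially of finite type then `S` is a G-ring." Here `IsGRing`
(`ExcellentRings.lean`: Noetherian with regular completion maps `A_𝔭 → (A_𝔭)^`) and Mathlib's
`Algebra.EssFiniteType` ("the localization of an algebra of finite type"). Users take
`(h : Stacks07PV)`. [cite: StacksProject, Tag 07PV] -/
def Stacks07PV : Prop :=
  ∀ (A B : Type u) [CommRing A] [CommRing B] [Algebra A B],
    IsGRing A → Algebra.EssFiniteType A B → IsGRing B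

/-! ## J-2 and quasi-excellence pass to essentially finite type algebras -/

/-- **J-2 passes to essentially finite type algebras**: `B` is a localization
(`Algebra.EssFiniteType.isLocalization`) of a finite type `A`-subalgebra
(`Algebra.EssFiniteType.subalgebra`), and J-2 passes to both (`IsJ2Ring.of_finiteType`,
`isJ2Ring_of_isLocalization`). [cite: StacksProject, Tag 07QU] -/
theorem IsJ2Ring.of_essFiniteType {A B : Type u} [CommRing A] [CommRing B] [Algebra A B]
    (hA : IsJ2Ring A) (hB : Algebra.EssFiniteType A B) : IsJ2Ring B :=
  haveI := hB
  isJ2Ring_of_isLocalization (Algebra.EssFiniteType.submonoid A B)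
    (hA.of_finiteType (B := Algebra.EssFiniteType.subalgebra A B) inferInstance)

/-- **Under `Stacks07PV`, quasi-excellence passes to essentially finite type algebras**
(Stacks 07QU with 07PV). [cite: StacksProject, Tag 07QU] -/
theorem IsQuasiExcellentRing.of_essFiniteType (h : Stacks07PV.{u}) {A B : Type u} [CommRing A]
    [CommRing B] [Algebra A B] (hA : IsQuasiExcellentRing A) (hB : Algebra.EssFiniteType A B) :
    IsQuasiExcellentRing B :=
  ⟨h A B hA.isGRing hB, hA.isJ2Ring.of_essFiniteType hB⟩

/-- **`Stacks07QU` from `Stacks07PV`**: a finite type algebra over a quasi-excellent ring is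
quasi-excellent (finite type is essentially finite type). [cite: StacksProject, Tag 07QU] -/
theorem stacks07QU_of_stacks07PV (h : Stacks07PV.{u}) : Stacks07QU.{u} :=
  fun _A _B _ _ _ hA hB =>
    haveI := hB
    IsQuasiExcellentRing.of_essFiniteType h hA inferInstance

/-- **Stacks 07QU for quasi-excellent rings, as printed** ("Any localization of a finite type
ring over a quasi-excellent ring is quasi-excellent"), from `Stacks07PV`: for `A`
quasi-excellent, `B` of finite type over `A` and `C` a localization of `B`, `C` is
quasi-excellent. [cite: StacksProject, Tag 07QU] -/
theorem Stacks07PV.stacks07QU_asPrinted (h : Stacks07PV.{u}) {A B C : Type u} [CommRing A]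
    [CommRing B] [CommRing C] [Algebra A B] [Algebra B C] (hA : IsQuasiExcellentRing A)
    (hB : Algebra.FiniteType A B) (M : Submonoid B) [IsLocalization M C] :
    IsQuasiExcellentRing C :=
  isQuasiExcellentRing_of_isLocalization M (stacks07QU_of_stacks07PV h A B hA hB)

/-! ## Consequence for the decomposition of `Temkin2008` -/

/-- **Temkin 2008, Thm. 2.3.6 (`Z = ∅`), weak form = `Temkin2008`**, with trust base
{`Temkin2008_prop234`, `Hironaka1964_local`, `Stacks07PV`}.
[cite: Temkin2008, Thm. 2.3.6 and Prop. 2.3.4] -/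
theorem temkin2008_of_stacks07PV (hP : Temkin2008_prop234.{u}) (hH : Hironaka1964_local.{u})
    (h : Stacks07PV.{u}) : Temkin2008.{u} :=
  temkin2008_of_localization' hP hH (stacks07QU_of_stacks07PV h)

end Literature.AlgebraicGeometry.Resolution

end
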